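import Mathlib
import Summits.Ventures.PercRepro2.SwOutCrossGenBare
import Summits.Ventures.PercRepro2.SwOutCrossGenCube

/-!
# Any number of independent junctions, each built by any list of steps (blind cell PercRepro2,
night-4 g24, 2026-08-28; proofs/NIGHT4-G24.md §14)

A **junction** is a finite non-empty u-arm set and a list of steps (connected cross components,
single dropped vertices).  Its cube has the inequality (`Junction.ineq`: `card_le_crossSteps`
through `ineq_cube_iff`), and the independent product of any list of junctions has it
(`card_le_crossJunctions`: `Cube.ineq_prodList`).
-/

namespace Summit.Ventures.PercRepro2

namespace CrossArm

/-- A junction: its u-arms (finite, non-empty, with decidable equality) and its list of steps. -/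
structure Junction : Type 1 where
  /-- the u-arms -/
  ι : Type
  /-- finiteness of the u-arms -/
  [fι : Fintype ι]
  /-- decidable equality of the u-arms -/
  [dι : DecidableEq ι]
  /-- at least one u-arm -/
  [nι : Nonempty ι]
  /-- the steps: connected cross components and single dropped vertices -/
  steps : List Step.{0}

/-- The cube of a junction. -/
def Junction.cube (J : Junction) : Cube.{0} :=
  letI := J.fι
  letI := J.dι
  (FibreIter.bare.steps J.steps).cube (ι := J.ι)

/-- **The inequality of a junction.** -/
theorem Junction.ineq (J : Junction) : J.cube.Ineq := by
  letI := J.fι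
  letI := J.dι
  letI := J.nι
  exact (ineq_cube_iff _).2 (card_le_crossSteps J.steps)

/-- **THE ABSTRACT THEOREM OF BOUNDARY (iv) FOR ANY NUMBER OF INDEPENDENT JUNCTIONS, EACH WITH
ANY NUMBER OF CONNECTED CROSS COMPONENTS AND SINGLE DROPPED VERTICES.** -/
theorem card_le_crossJunctions (J : Junction) (Js : List Junction) :
    (J.cube.prodList (Js.map Junction.cube)).Ineq :=
  Cube.ineq_prodList _ J.ineq _ fun D hD => by
    obtain ⟨J', -, rfl⟩ := List.mem_map.1 hD
    exact J'.ineq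

end CrossArm

end Summit.Ventures.PercRepro2
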